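import Literature.AnabelianGeometry.EtaleTheta.Discharge.Sec2InnerInducesOnTheta
import Literature.AnabelianGeometry.EtaleTheta.Discharge.Sec2OrbitEmbeddingRootNonempty
import HarnessLib

/-!
# [EtTh] Def 2.7 at the §1 model: EVERY class of the collections of `ThetaOrbitData.ofEmbedding` is
# inhabited (`η̈^{Θ,ℤ×μ₂} ⊇ η̈^{Θ,l·ℤ×μ₂} ⊇ η̈^{Θ,l·ℤ}` and `η̲̈^{Θ,l·ℤ×μ₂} ⊇ η̲̈^{Θ,l·ℤ}`)

Mochizuki, *The Étale Theta Function …* [EtTh], Publ. RIMS 45 (2009), §2, Def 2.7, PRIMS PDF p.41 (bib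
key `MochizukiEtTh2009`).

PROOF-ONLY companion (no `def`; seat abc-iut-L2-t2) of `ThetaRootOrbitsOfSetting.lean`, completing
`Discharge/Sec2OrbitEmbeddingRootNonempty.lean` (the root class of `η̈^Θ` itself is inhabited): by the
transport formula of `Discharge/Sec2Cor28iiiInnerOfEmbedding.lean` (`image_rootClassOf_eq`: the inner
automorphism `γ_{ι σ⁻¹}` with its induced `Γ_Θ` — which exists, `exists_inducesOnTheta_innerAutTop` — maps
the root class of `x` onto the root class of `σ·x`), the root class of EVERY conjugate `σ·η̈^Θ`,
`σ ∈ Π^tp_{X̲̲}`, is inhabited (`rootClassOf_conj_nonempty`); hence every member of `η̲̈^{Θ,l·ℤ×μ₂}`,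
`η̲̈^{Θ,l·ℤ}` is inhabited (`ofEmbedding_rootLZMu2_member_nonempty`, `…rootLZ…`), as is every member of the
three class collections (`ofEmbedding_orbitColl_member_nonempty`). So no clause of the orbit datum
(`root_pow`, `IsStandardColl`, `EqUpToRootOfUnity`) is vacuous for emptiness reasons. HONEST FRAMING:
[EtTh] is refereed; no side is taken on [IUTchIII] Cor 3.12; nothing beyond the displayed statements is
claimed.
-/

noncomputable section

namespace Literature.AnabelianGeometry.EtaleTheta

open Literature.AnabelianGeometry.SemiGraphs ThetaCovers

universe u

namespace ThetaSetting.EtaleThetaData.DoubleUnderline.OrbitEmbedding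

variable {p : ℕ} [Fact p.Prime] {D : ThetaSetting p} {E : D.EtaleThetaData} {l : ℕ}
  {C : E.DoubleUnderline l} {T : TemperedCoverData.{u} l} (ε : C.OrbitEmbedding T)

/-- **The root class of every conjugate `σ·η̈^Θ`, `σ ∈ Π^tp_{X̲̲}`, is inhabited**: it is the image of the
(inhabited) root class of `η̈^Θ` under the transport by `(γ_{ισ⁻¹}, Γ_Θ)`.
[cite: MochizukiEtTh2009, Def 2.7 p.41] -/
theorem rootClassOf_conj_nonempty [hN : D.GtpYdd.Normal] (hC : D.Compat) (hS : D.Sec2Hyps)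
    {σ : D.PiTemp} (hσ : σ ∈ C.Huu) :
    (ε.rootClassOf (ContH1.conj D.toTheta D.DeltaTheta σ E.etaDd)).Nonempty := by
  haveI : ε.bot.Normal := ε.normal_bot
  obtain ⟨ΓΘ, hind, -⟩ :=
    (ThetaOrbitData.ofEmbedding ε hC hS).exists_inducesOnTheta_innerAutTop (ε.ι σ⁻¹)
  have hΘ := ε.symm_coeffOf_of_induces hC hS σ⁻¹ ΓΘ hind
  have himg := ε.image_rootClassOf_eq (C.Huu.inv_mem hσ) ΓΘ hΘ (ε.conj_mem_PiYddtp σ⁻¹)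
    (ε.conj_mem_PiYdduu (C.Huu.inv_mem hσ)) E.etaDd
  have hx : ContH1.conj D.toTheta D.DeltaTheta σ⁻¹⁻¹ E.etaDd =
      ContH1.conj D.toTheta D.DeltaTheta σ E.etaDd := by rw [inv_inv]
  rw [hx] at himg
  rw [← himg]
  exact ε.rootClassOf_etaDd_nonempty.image _

/-- Every member of a transported orbit collection `orbitColl S` is inhabited.
[cite: MochizukiEtTh2009, Def 2.7 p.41] -/
theorem orbitColl_member_nonempty (hC : D.Compat) {S : Set D.PiTemp}
    {c : Set (↥T.PiYddtp → ε.Coeff)} (hc : c ∈ ε.orbitColl hC S) : c.Nonempty := by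
  obtain ⟨σ, -, rfl⟩ := hc
  exact ε.classOf_nonempty _

/-- Every member of a root-orbit collection `rootColl S`, `S ⊆ Π^tp_{X̲̲}`, is inhabited.
[cite: MochizukiEtTh2009, Def 2.7 p.41] -/
theorem rootColl_member_nonempty (hC : D.Compat) (hS : D.Sec2Hyps) {S : Set D.PiTemp}
    (hSH : S ⊆ C.Huu) {c : Set (↥(T.PiYddtp ⊓ T.tp T.PiXuu) → ε.Coeff)} (hc : c ∈ ε.rootColl hC S) :
    c.Nonempty := by
  haveI := hC.GtpYdd_normal
  obtain ⟨σ, hσ, rfl⟩ := hc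
  exact ε.rootClassOf_conj_nonempty hC hS (hSH hσ)

end ThetaSetting.EtaleThetaData.DoubleUnderline.OrbitEmbedding

namespace ThetaCovers.ThetaOrbitData

variable {p : ℕ} [Fact p.Prime] {D : ThetaSetting p} {E : D.EtaleThetaData} {l : ℕ}
  {C : E.DoubleUnderline l} {T : TemperedCoverData.{u} l} (ε : C.OrbitEmbedding T)

/-- **Every member of `η̲̈^{Θ,l·ℤ×μ₂}` of `ofEmbedding` is inhabited.** [cite: MochizukiEtTh2009, Def 2.7 p.41] -/
theorem ofEmbedding_rootLZMu2_member_nonempty (hC : D.Compat) (hS : D.Sec2Hyps)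
    {c : Set (↥(T.PiYddtp ⊓ T.tp T.PiXuu) → (ofEmbedding ε hC hS).DeltaTheta)}
    (hc : c ∈ (ofEmbedding ε hC hS).rootLZMu2) : c.Nonempty :=
  ε.rootColl_member_nonempty hC hS (fun _ h => h) hc

/-- **Every member of `η̲̈^{Θ,l·ℤ}` of `ofEmbedding` is inhabited.** [cite: MochizukiEtTh2009, Def 2.7 p.41] -/
theorem ofEmbedding_rootLZ_member_nonempty (hC : D.Compat) (hS : D.Sec2Hyps)
    {c : Set (↥(T.PiYddtp ⊓ T.tp T.PiXuu) → (ofEmbedding ε hC hS).DeltaTheta)}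
    (hc : c ∈ (ofEmbedding ε hC hS).rootLZ) : c.Nonempty :=
  ε.rootColl_member_nonempty hC hS (fun _ h => h.1) hc

/-- Every member of `η̈^{Θ,ℤ×μ₂}`, `η̈^{Θ,l·ℤ×μ₂}`, `η̈^{Θ,l·ℤ}` of `ofEmbedding` is inhabited.
[cite: MochizukiEtTh2009, Def 2.7 p.41] -/
theorem ofEmbedding_orbitColl_member_nonempty (hC : D.Compat) (hS : D.Sec2Hyps)
    {c : Set (↥T.PiYddtp → (ofEmbedding ε hC hS).DeltaTheta)} :
    (c ∈ (ofEmbedding ε hC hS).etaZMu2 → c.Nonempty) ∧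
      (c ∈ (ofEmbedding ε hC hS).etaLZMu2 → c.Nonempty) ∧
      (c ∈ (ofEmbedding ε hC hS).etaLZ → c.Nonempty) :=
  ⟨fun hc => ε.orbitColl_member_nonempty hC hc, fun hc => ε.orbitColl_member_nonempty hC hc,
    fun hc => ε.orbitColl_member_nonempty hC hc⟩

end ThetaCovers.ThetaOrbitData

end Literature.AnabelianGeometry.EtaleTheta

end
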